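import Summits.HodgeConjecture.HodgeConjecture.Theorems.R90S6TwistedShellLatticeDict   -- ★ L1∕J2′ `mul_mul_mem_doubleCoset_iff`, `inv_mul_mem_doubleCoset_iff_relPos_eq` (brings ★ `R90S6LatticeInvPolarity`: `qsInvolution_zpowDiagGL`, `qsInvolution_mem_glInt`;
                                                                                        --   ★ `R90S6LatticeInvCalculus`: `relPos`, `antitone_relPos`; ★ `CartanDecompositionGLnUnique`: `exists_glInt_mul_zpowDiagGL_mul_eq_iff`; ★ `zpowDiagGL`, `diagonalGL_mem_glInt`;
                                                                                        --   ★ `ValuedFieldValuativeRelBridge`: `v_eq_one_iff_valuation_eq_one`; ★ `UnitaryGroup.coe_qsInvolution_apply`)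
import HarnessLib

/-!
# R90 · S6 «Ch. 14.1–14.5 stable trace formula» — card TL4 (rows E1.4.4.2.2 first brick + E1.4.4.2.1 hyperbolic clause): THE APARTMENT LAYER —
# THE DIAGONAL TWISTED-SHELL DICTIONARY `x⁻¹ δ Θ_σ(x) ∈ K̃ ϖ^λ K̃ ⟺ (c − a − w₀a) is a permutation of λ` (`Theorems/R90S6ApartmentTwistedShell.lean`)

Cell `hodgecm-mathlib`, crux H413 (`stmt-HodgeConjecture-24833`), route of record `HCCMUnconditional`; programme R90-TF (brief `director/R90-BRIEF.v2.md`
1f40d54518340a35), section S6 (base `R90-C14`, dealer R90-C14-plan (g2)), seat R90-C14-p10 (g2); CARD TL4 dealt BY NAME 2026-09-05T02:00:44Z (R90 bus).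
Lane `--kind proof --supports stmt-HodgeConjecture-24833 --as helper`; THEOREMS ONLY (no definition, no instance, no notation, no named fact, no kit, no `sorry`);
imports = ★ L1∕J2′ `Theorems/R90S6TwistedShellLatticeDict` (R90-C14-p08 (g0); brings ★ L1 `R90S6LatticeInvCalculus` ∕ `R90S6LatticeInvPolarity` of this lineage,
★ `CartanDecompositionGLnUnique`, ★ `ValuedFieldValuativeRelBridge`) + HarnessLib (Theorems → Theorems ∕ Literature; never `Lines/`).

## THE MATHEMATICS ([Kottwitz1986BaseChangeUnits] §1 pp. 239–242, §3; [Rogawski1990] §4.10 pp. 57–58; [Macdonald1995] Ch. V §2 (2.2)–(2.6))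

FRAME = ★ L1's: `K` a field with `Valued K ℤᵐ⁰` and a compatible `ValuativeRel K` whose integers form a DVR, `ϖ` a uniformizing element, `K̃ = GL_N(𝒪) = glInt N K`,
`ϖ^a = zpowDiagGL _ a` (`a ∈ ℤ^N`), `σ : K →+* K` VALUATION-PRESERVING (`hvσ`; `σ ϖ = ϖ` is NOT needed anywhere below — valuations absorb the unit `σ(ϖ)∕ϖ`),
`Θ_σ = UnitaryGroup.qsInvolution σ` (`g ↦ w⁰ ᵗ(σg)⁻¹ w⁰`, the quasi-split involution whose fixed points are `U(σ, w⁰)`), `w₀ a = a ∘ rev`.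
The TWISTED SHELL predicate of ★ J1′ `epsOrbitalIntegral_indicator_quotientMeasure_eq_mul_ncard_shell` ∕ ★ J2′ `ncard_twistedShell_eq_ncard_latt_relPos_dual` is
`x⁻¹ · δ · Θ_σ(x) ∈ K̃ ϖ^λ K̃` (`x K̃ ∈ GL_N(K) ⧸ K̃`); this file EVALUATES it on the STANDARD APARTMENT `x = diag(t)` (`v(t_i) = v(ϖ^{a_i})`) for a DIAGONAL
`δ = diag(d)` (`v(d_i) = v(ϖ^{c_i})`) — the ε-semisimple `δ` whose norm `δ Θ_σ(δ)` lies in the diagonal (hyperbolic) torus: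

* §1 (A.1) **`qsInvolution_diagonalGL`** `Θ_σ(diag u) = diag(σ(u_{rev i})⁻¹)` (any field; ★ `UnitaryGroup.coe_qsInvolution_apply`), and (A.4a)
  **`qsInvolution_diagonalGL_eq_self_iff`** `Θ_σ(diag τ) = diag τ ⟺ ∀ i, τ_i · σ(τ_{rev i}) = 1` — the DIAGONAL ε-TWISTED CENTRALISER of a diagonal `δ` is the torus
  `T = U(σ, w⁰) ∩ diag` (`t⁻¹ δ Θ_σ(t) = δ ⟺ Θ_σ t = t` for diagonal `t`; at `N = 3`: `τ = (s, u, σ(s)⁻¹)`, `u σ(u) = 1`, i.e. `T ≅ E^× × E¹`, valuation vectors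
  `(m, 0, −m)`);
* §2 (A.2) **`diagonalGL_mem_doubleCoset_iff_exists_perm`** `diag(u) ∈ K̃ ϖ^λ K̃ ⟺ ∃ τ ∈ 𝔖_N, ∀ i, e (τ i) = λ i` for `v(u_i) = v(ϖ^{e_i})` — NO antitone
  hypothesis on `λ` (★ `CartanUnique.exists_glInt_mul_zpowDiagGL_mul_eq_iff` «`K̃ ϖ^e K̃ = K̃ ϖ^λ K̃` iff `e` is a permutation of `λ`» + ★ `diagonalGL_mem_glInt` for the
  unit part + ★ L1 §0 bi-`K̃`-invariance); for antitone `λ` the right side says `sort e = λ`, i.e. `relPos = λ` (★ L1 `inv_mul_mem_doubleCoset_iff_relPos_eq`);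
* §3 (A.3a) **`diagonalGL_inv_mul_diagonalGL_mul_qsInvolution`** the explicit diagonal form `diag(t)⁻¹ · diag(d) · Θ_σ(diag t) = diag(t_i⁻¹ d_i σ(t_{rev i})⁻¹)` — the
  constant-term currency (valuation vector `c − a − w₀a`) — and the HEAD (A.3) **`diagonalGL_inv_mul_diagonalGL_mul_qsInvolution_mem_doubleCoset_iff`**:
  **`diag(t)⁻¹ · diag(d) · Θ_σ(diag t) ∈ K̃ ϖ^λ K̃ ⟺ ∃ τ ∈ 𝔖_N, ∀ i, c (τ i) − a (τ i) − a (rev (τ i)) = λ i`**, with its apartment-VERTEX edition (A.3v) at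
  `x = ϖ^a` (`zpowDiagGL_inv_mul_diagonalGL_mul_qsInvolution_mem_doubleCoset_iff`) and the LATTICE reading (A.3′)
  **`relPos_zpowDiagGL_diagonalGL_mul_qsInvolution_eq_iff`** `inv(ϖ^a·𝒪^N, δ·(ϖ^a·𝒪^N)^♯) = relPos (ϖ^a) (δ Θ_σ ϖ^a) = λ ⟺ λ antitone ∧ (c − a − w₀a) ~ λ`
  (★ L1 §1 + ★ J2′ §2 `latt_mul_qsInvolution` for the words `δ·Λ^♯`);
* §4 (A.4) **`inv_mul_mul_qsInvolution_diagonalGL_mul`** the `T`-ACTION LAW `(t x)⁻¹ · δ · Θ_σ(t x) = x⁻¹ · δ · Θ_σ(x)` for `t ∈ T` (`Θ_σ t = t`), diagonal `δ` and EVERY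
  `x ∈ GL_N(K)` (not only apartment cosets): the twisted position to `δ` is constant on `T`-orbits in `GL_N(K) ⧸ K̃`; on the apartment `T` acts through the valuation
  shifts `a ↦ a + s`, `s + w₀ s = 0` (`(m, 0, −m)` at `N = 3`), under which `c − a − w₀a` is invariant — (A.5a) **`sub_sub_rev_add_of_add_rev_eq_zero`** — so the
  apartment count of TB2a's twisted constant term at a hyperbolic-norm `δ` runs over `ℤ^N ⧸ {s : s + w₀s = 0}`, `≅ ℤ²` via `(a₀ + a₂, a₁)` at `N = 3` by (A.5b)
  **`sub_sub_rev_fin_three`**: exponent vector `(c₀ − (a₀+a₂), c₁ − 2a₁, c₂ − (a₀+a₂))`.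

CONSUMERS BY NAME: R90-C14-p01 (g2)'s TB2a `Theorems/R90S6TwistedConstantTermTransport.lean` (the ε-twisted `M̃`-integral at hyperbolic `δ` is a finite sum of
(A.3a)-values over the classes of §4), and row E1.4.4.2.2's retraction census (lattices off the apartment).  Valuation binders are NORMALISATION-FREE
(`Valued.v (t i) = Valued.v (ϖ ^ a i)`); holders of `Valued.v ϖ = exp (−1)` convert with ★ `CartanUnique.v_uniformizer_zpow`.
HONEST LABEL: apartment-level dictionary (pure `GL_N` algebra over a discretely valued field), count-neutral until TB2a ∕ E1.4.4.2.2 consume it; proves no printed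
global statement, discharges no citation; HC_CM is proved only modulo the 7 printed citations (2 remaining named inputs: hLiu418 = stmt-HodgeConjecture-24832,
h413 = stmt-HodgeConjecture-24833) until rung 0 closes.  REL ≠ ★ ≠ BUILT.

## References
* [Kottwitz1986BaseChangeUnits] R. E. Kottwitz, *Base change for unit elements of Hecke algebras*, Compositio Math. 60 (1986): §1 pp. 239–242 (`TO_δ(f) =
  ∫_{G_{δσ}∖G(L)} f(g⁻¹ δ σ(g)) dg`, the set `X_L` of lattices and «inv»), §3 (the apartment ∕ torus computation).
* [Rogawski1990] J. D. Rogawski, *Automorphic Representations of Unitary Groups in Three Variables*, Ann. of Math. Stud. 123 (1990): §1.9–§1.10 pp. 8–9 (`Θ`, `w⁰`,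
  the diagonal torus of `U(3)`), §3.11 pp. 34–35 (ε-centralisers, norm), §4.10 pp. 57–58 (twisted orbital integrals, (4.10.2)–(4.10.3)).
* [Macdonald1995] I. G. Macdonald, *Symmetric Functions and Hall Polynomials*, 2nd ed. (1995): Ch. V §2 (2.2) («each double coset `KxK` has a unique representative
  `π^λ`, `λ₁ ≥ ⋯ ≥ λ_n`»), (2.6).
-/

set_option autoImplicit false
-- the mandated namespace repeats the single-problem summit's segment (`HodgeConjecture.HodgeConjecture`)
set_option linter.dupNamespace false

noncomputable section

open scoped Valued WithZero Matrix MatrixGroups Pointwise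
open Literature.NumberTheory.Automorphic Literature.NumberTheory.Automorphic.HermitianLattice Literature.NumberTheory.Automorphic.UnitaryLatticeTree

namespace Summit.HodgeConjecture.HodgeConjecture.R90.S6

/-! ## §1 `Θ_σ` on the diagonal torus; the diagonal ε-twisted centraliser `T = U(σ, w⁰) ∩ diag` -/

section Diagonal

variable {K : Type*} [Field K] {σ : K →+* K} {N : ℕ}

/-- **(A.1) `Θ_σ(diag u) = diag(σ(u_{rev i})⁻¹)`**: the quasi-split involution `Θ_σ(g) = w⁰ ᵗ(σg)⁻¹ w⁰` maps the diagonal torus to itself, inverting, applying `σ`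
and reversing the order of the entries (★ `UnitaryGroup.coe_qsInvolution_apply`: `Θ_σ(g) i j = σ((g⁻¹) (rev j) (rev i))`; the `zpowDiagGL` case `Θ_σ(ϖ^a) = ϖ^{−w₀a}`
for `σ ϖ = ϖ` is ★ `R90.S6.qsInvolution_zpowDiagGL`). [cite: Rogawski1990, §1.9–§1.10 pp. 8–9] -/
theorem qsInvolution_diagonalGL (u : Fin N → Kˣ) :
    UnitaryGroup.qsInvolution σ (diagonalGL (Fin N) K u) =
      diagonalGL (Fin N) K fun i => (Units.map (σ : K →* K) (u (Fin.rev i)))⁻¹ := by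
  refine Matrix.GeneralLinearGroup.ext fun i j => ?_
  rw [UnitaryGroup.coe_qsInvolution_apply, ← map_inv (diagonalGL (Fin N) K) u, coe_diagonalGL, coe_diagonalGL,
    Matrix.diagonal_apply, Matrix.diagonal_apply]
  by_cases hij : i = j
  · subst hij
    rw [if_pos rfl, if_pos rfl, Pi.inv_apply, Units.coe_map_inv, MonoidHom.coe_coe]
  · rw [if_neg (fun h => hij (Fin.rev_injective h).symm), if_neg hij, map_zero]

/-- **(A.4a) THE DIAGONAL ε-TWISTED CENTRALISER**: `Θ_σ(diag τ) = diag τ ⟺ ∀ i, τ_i · σ(τ_{rev i}) = 1` — the diagonal elements fixed by `Θ_σ` (= the diagonal torus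
`T` of the quasi-split unitary group `U(σ, w⁰)`, ★ `UnitaryGroup.mem_unitaryGroupOfForm_iff_qsInvolution_eq`; at `N = 3`: `τ = (s, u, σ(s)⁻¹)` with `u σ(u) = 1`,
`T ≅ E^× × E¹`).  Since diagonal matrices commute, for diagonal `t`, `δ`: `t⁻¹ δ Θ_σ(t) = δ ⟺ Θ_σ t = t`, so `T` is the diagonal part of the ε-twisted centraliser
of every diagonal `δ`. [cite: Rogawski1990, §1.9 p. 8; §3.11 pp. 34–35] -/
theorem qsInvolution_diagonalGL_eq_self_iff (u : Fin N → Kˣ) :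
    UnitaryGroup.qsInvolution σ (diagonalGL (Fin N) K u) = diagonalGL (Fin N) K u ↔
      ∀ i, (u i : K) * σ (u (Fin.rev i)) = 1 := by
  rw [qsInvolution_diagonalGL]
  constructor
  · intro h i
    have hi := congrArg (fun g : GL (Fin N) K => (g : Matrix (Fin N) (Fin N) K) i i) h
    simp only [coe_diagonalGL, Matrix.diagonal_apply_eq, Units.val_inv_eq_inv_val] at hi
    -- `hi : (σ (u (rev i)))⁻¹ = u i` (up to the `rfl`-coercion `Units.coe_map`)
    rw [← hi]
    exact inv_mul_cancel₀ ((map_ne_zero σ).2 (u (Fin.rev i)).ne_zero)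
  · intro h
    congr 1
    funext i
    refine inv_eq_of_mul_eq_one_left (Units.ext ?_)
    rw [Units.val_mul, Units.coe_map, MonoidHom.coe_coe, Units.val_one]
    exact h i

/-- **(A.3a) THE TWISTED POSITION ON THE APARTMENT, EXPLICITLY**: `diag(t)⁻¹ · diag(d) · Θ_σ(diag t) = diag(t_i⁻¹ · d_i · σ(t_{rev i})⁻¹)` (diagonal matrices multiply
entrywise; (A.1)).  Valuation vector: `c − a − w₀a` when `v(t_i) = v(ϖ^{a_i})`, `v(d_i) = v(ϖ^{c_i})` — the ε-NORM-FIBRE coordinates the twisted constant term is summed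
over. [cite: Kottwitz1986BaseChangeUnits, §3] [cite: Rogawski1990, §4.10 p. 58] -/
theorem diagonalGL_inv_mul_diagonalGL_mul_qsInvolution (t d : Fin N → Kˣ) :
    (diagonalGL (Fin N) K t)⁻¹ * diagonalGL (Fin N) K d * UnitaryGroup.qsInvolution σ (diagonalGL (Fin N) K t) =
      diagonalGL (Fin N) K fun i => (t i)⁻¹ * d i * (Units.map (σ : K →* K) (t (Fin.rev i)))⁻¹ := by
  rw [qsInvolution_diagonalGL, ← map_inv (diagonalGL (Fin N) K) t, ← map_mul, ← map_mul]
  rfl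

/-- **(A.4) THE `T`-ACTION LAW**: for `t = diag τ ∈ T` (`∀ i, τ_i σ(τ_{rev i}) = 1`, i.e. `Θ_σ t = t`, (A.4a)), a diagonal `δ = diag d` and EVERY `x ∈ GL_N(K)`:
`(t x)⁻¹ · δ · Θ_σ(t x) = x⁻¹ · δ · Θ_σ(x)` (`Θ_σ` is multiplicative, ★ `UnitaryGroup.qsInvolution_mul`, `Θ_σ t = t`, and `t⁻¹ δ t = δ` as diagonal matrices commute) —
the twisted position to `δ` is constant on the `T`-orbits of `GL_N(K) ⧸ K̃`; on the apartment `x = diag`, `T` acts through the valuation shifts `a ↦ a + s`, `s + w₀s = 0`.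
[cite: Rogawski1990, §4.10 (4.10.2) p. 58; §3.11 p. 35] [cite: Kottwitz1986BaseChangeUnits, §1 p. 240] -/
theorem inv_mul_mul_qsInvolution_diagonalGL_mul {τ : Fin N → Kˣ} (hτ : ∀ i, (τ i : K) * σ (τ (Fin.rev i)) = 1) (d : Fin N → Kˣ)
    (x : GL (Fin N) K) :
    (diagonalGL (Fin N) K τ * x)⁻¹ * diagonalGL (Fin N) K d * UnitaryGroup.qsInvolution σ (diagonalGL (Fin N) K τ * x) =
      x⁻¹ * diagonalGL (Fin N) K d * UnitaryGroup.qsInvolution σ x := by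
  have hcomm : (diagonalGL (Fin N) K τ)⁻¹ * diagonalGL (Fin N) K d * diagonalGL (Fin N) K τ = diagonalGL (Fin N) K d := by
    rw [← map_inv (diagonalGL (Fin N) K) τ, ← map_mul, ← map_mul, inv_mul_cancel_comm]
  rw [UnitaryGroup.qsInvolution_mul, (qsInvolution_diagonalGL_eq_self_iff τ).2 hτ, mul_inv_rev]
  calc x⁻¹ * (diagonalGL (Fin N) K τ)⁻¹ * diagonalGL (Fin N) K d * (diagonalGL (Fin N) K τ * UnitaryGroup.qsInvolution σ x)
      = x⁻¹ * ((diagonalGL (Fin N) K τ)⁻¹ * diagonalGL (Fin N) K d * diagonalGL (Fin N) K τ) * UnitaryGroup.qsInvolution σ x := by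
        simp only [mul_assoc]
    _ = x⁻¹ * diagonalGL (Fin N) K d * UnitaryGroup.qsInvolution σ x := by rw [hcomm]

end Diagonal

/-! ## §2 Diagonal elements in the Cartan shells `K̃ ϖ^λ K̃` -/

section Shell

variable {K : Type*} [Field K] [Valued K ℤᵐ⁰] [ValuativeRel K] [(Valued.v : Valuation K ℤᵐ⁰).Compatible] {σ : K →+* K} {N : ℕ}
  [IsDiscreteValuationRing (ValuativeRel.valuation K).integer] {ϖ : K} (hϖ : IsUniformizingElement ϖ)
include hϖ

/-- **(A.2) DIAGONAL ELEMENTS IN CARTAN SHELLS**: if `v(u_i) = v(ϖ^{e_i})` then `diag(u) ∈ K̃·ϖ^λ·K̃ ⟺ e` is a permutation of `λ` (`∃ τ ∈ 𝔖_N, ∀ i, e (τ i) = λ i`), for ANY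
`λ ∈ ℤ^N` (no sorting): `diag(u) = diag(w)·ϖ^e` with `diag(w) ∈ K̃` (`v(w_i) = 1`, ★ `diagonalGL_mem_glInt`), the shell is bi-`K̃`-invariant (★ L1 `mul_mul_mem_doubleCoset_iff`),
and `ϖ^e ∈ K̃ ϖ^λ K̃ ⟺ e ~ λ` is ★ `CartanUnique.exists_glInt_mul_zpowDiagGL_mul_eq_iff` (Macdonald V (2.2): the `K̃`-double cosets of the `ϖ^e` are classified by the
multiset of exponents).  For antitone `λ` this reads `relPos = λ` (★ L1 `inv_mul_mem_doubleCoset_iff_relPos_eq`). [cite: Macdonald1995, Ch. V §2 (2.2), (2.6)] -/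
theorem diagonalGL_mem_doubleCoset_iff_exists_perm {u : Fin N → Kˣ} {e : Fin N → ℤ}
    (hu : ∀ i, Valued.v (u i : K) = Valued.v (ϖ ^ e i)) (la : Fin N → ℤ) :
    diagonalGL (Fin N) K u ∈ (glInt N K : Set (GL (Fin N) K)) * {zpowDiagGL hϖ.ne_zero la} * (glInt N K : Set (GL (Fin N) K)) ↔
      ∃ τ : Equiv.Perm (Fin N), ∀ i, e (τ i) = la i := by
  have hv0 : ∀ n : ℤ, Valued.v (ϖ ^ n) ≠ 0 := fun n => (Valuation.ne_zero_iff _).2 (zpow_ne_zero n hϖ.ne_zero)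
  -- the unit part `w_i = u_i ϖ^{-e_i}`
  have hw : diagonalGL (Fin N) K (fun i => u i * (Units.mk0 ϖ hϖ.ne_zero ^ e i)⁻¹) ∈ glInt N K := by
    refine diagonalGL_mem_glInt fun i => (v_eq_one_iff_valuation_eq_one _).1 ?_
    rw [Units.val_mul, Units.val_inv_eq_inv_val, Units.val_zpow_eq_zpow_val, Units.val_mk0, map_mul, map_inv₀, hu i,
      mul_inv_cancel₀ (hv0 (e i))]
  have hsplit : diagonalGL (Fin N) K u =
      diagonalGL (Fin N) K (fun i => u i * (Units.mk0 ϖ hϖ.ne_zero ^ e i)⁻¹) * zpowDiagGL hϖ.ne_zero e * 1 := by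
    rw [mul_one, zpowDiagGL, ← map_mul]
    congr 1
    funext i
    rw [Pi.mul_apply, inv_mul_cancel_right]
  rw [hsplit, mul_mul_mem_doubleCoset_iff (zpowDiagGL hϖ.ne_zero la) hw (glInt N K).one_mem]
  change zpowDiagGL hϖ.ne_zero e ∈ DoubleCoset.doubleCoset (zpowDiagGL hϖ.ne_zero la) (glInt N K : Set (GL (Fin N) K)) (glInt N K) ↔ _
  rw [DoubleCoset.mem_doubleCoset, ← CartanUnique.exists_glInt_mul_zpowDiagGL_mul_eq_iff hϖ]
  constructor
  · rintro ⟨x, hx, y, hy, h⟩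
    exact ⟨x, hx, y, hy, h.symm⟩
  · rintro ⟨x, hx, y, hy, h⟩
    exact ⟨x, hx, y, hy, h.symm⟩

/-! ## §3 The twisted shell predicate on the standard apartment -/

/-- **(A.3) HEAD — THE DIAGONAL TWISTED-SHELL DICTIONARY**: for `σ` valuation-preserving, a diagonal `δ = diag(d)` with `v(d_i) = v(ϖ^{c_i})`, a diagonal
`x = diag(t)` with `v(t_i) = v(ϖ^{a_i})` and ANY `λ ∈ ℤ^N`:
**`x⁻¹ · δ · Θ_σ(x) ∈ K̃·ϖ^λ·K̃ ⟺ ∃ τ ∈ 𝔖_N, ∀ i, c (τ i) − a (τ i) − a (rev (τ i)) = λ i`** — the twisted relative position of the apartment point `x K̃` to `δ`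
is the SORT of `c − a − w₀a` ((A.3a) + (A.2); the valuation of `t_i⁻¹ d_i σ(t_{rev i})⁻¹` is `v(ϖ^{c_i − a_i − a_{rev i}})` by `hvσ`).  This is the standard-apartment
evaluation of the shell predicate counted by ★ J1′ `epsOrbitalIntegral_indicator_quotientMeasure_eq_mul_ncard_shell` and transported to lattices by ★ J2′
`ncard_twistedShell_eq_ncard_latt_relPos_dual`. [cite: Kottwitz1986BaseChangeUnits, §1 pp. 239–242, §3] [cite: Rogawski1990, §4.10 pp. 57–58]
[cite: Macdonald1995, Ch. V §2 (2.2)] -/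
theorem diagonalGL_inv_mul_diagonalGL_mul_qsInvolution_mem_doubleCoset_iff (hvσ : ∀ a, Valued.v (σ a) = Valued.v a)
    {t d : Fin N → Kˣ} {a c : Fin N → ℤ} (ht : ∀ i, Valued.v (t i : K) = Valued.v (ϖ ^ a i))
    (hd : ∀ i, Valued.v (d i : K) = Valued.v (ϖ ^ c i)) (la : Fin N → ℤ) :
    (diagonalGL (Fin N) K t)⁻¹ * diagonalGL (Fin N) K d * UnitaryGroup.qsInvolution σ (diagonalGL (Fin N) K t) ∈
        (glInt N K : Set (GL (Fin N) K)) * {zpowDiagGL hϖ.ne_zero la} * (glInt N K : Set (GL (Fin N) K)) ↔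
      ∃ τ : Equiv.Perm (Fin N), ∀ i, c (τ i) - a (τ i) - a (Fin.rev (τ i)) = la i := by
  have hv0 : Valued.v ϖ ≠ 0 := (Valuation.ne_zero_iff _).2 hϖ.ne_zero
  rw [diagonalGL_inv_mul_diagonalGL_mul_qsInvolution]
  refine diagonalGL_mem_doubleCoset_iff_exists_perm hϖ (e := fun i => c i - a i - a (Fin.rev i)) (fun i => ?_) la
  rw [Units.val_mul, Units.val_mul, Units.val_inv_eq_inv_val, Units.val_inv_eq_inv_val, Units.coe_map, MonoidHom.coe_coe,
    map_mul, map_mul, map_inv₀, map_inv₀, hvσ, ht, hd, ht, map_zpow₀, map_zpow₀, map_zpow₀, map_zpow₀, zpow_sub₀ hv0,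
    zpow_sub₀ hv0, div_eq_mul_inv, div_eq_mul_inv, mul_comm ((Valued.v ϖ ^ a i)⁻¹)]

/-- **(A.3v) THE APARTMENT-VERTEX EDITION** at `x = ϖ^a` (`zpowDiagGL`, the canonical representatives of the apartment `T̃(K) ⧸ T̃(𝒪) ≅ ℤ^N`):
`(ϖ^a)⁻¹ · diag(d) · Θ_σ(ϖ^a) ∈ K̃·ϖ^λ·K̃ ⟺ ∃ τ ∈ 𝔖_N, ∀ i, c (τ i) − a (τ i) − a (rev (τ i)) = λ i` ((A.3) with `t_i = ϖ^{a_i}`).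
[cite: Kottwitz1986BaseChangeUnits, §3] [cite: Macdonald1995, Ch. V §2 (2.2)] -/
theorem zpowDiagGL_inv_mul_diagonalGL_mul_qsInvolution_mem_doubleCoset_iff (hvσ : ∀ a, Valued.v (σ a) = Valued.v a)
    {d : Fin N → Kˣ} {c : Fin N → ℤ} (hd : ∀ i, Valued.v (d i : K) = Valued.v (ϖ ^ c i)) (a la : Fin N → ℤ) :
    (zpowDiagGL hϖ.ne_zero a)⁻¹ * diagonalGL (Fin N) K d * UnitaryGroup.qsInvolution σ (zpowDiagGL hϖ.ne_zero a) ∈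
        (glInt N K : Set (GL (Fin N) K)) * {zpowDiagGL hϖ.ne_zero la} * (glInt N K : Set (GL (Fin N) K)) ↔
      ∃ τ : Equiv.Perm (Fin N), ∀ i, c (τ i) - a (τ i) - a (Fin.rev (τ i)) = la i :=
  diagonalGL_inv_mul_diagonalGL_mul_qsInvolution_mem_doubleCoset_iff hϖ hvσ (t := fun i => Units.mk0 ϖ hϖ.ne_zero ^ a i)
    (fun i => by rw [Units.val_zpow_eq_zpow_val, Units.val_mk0]) hd la

/-- **(A.3′) THE LATTICE READING — `inv(ϖ^a·𝒪^N, δ·(ϖ^a·𝒪^N)^♯) = λ ⟺ λ = sort(c − a − w₀a)`**: for `σ` valuation-preserving, `δ = diag(d)` with `v(d_i) = v(ϖ^{c_i})`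
and `a, λ ∈ ℤ^N`: `relPos (ϖ^a) (δ Θ_σ ϖ^a) = λ ⟺ λ` is antitone and `c − a − w₀a` is a permutation of `λ` (★ L1 `inv_mul_mem_doubleCoset_iff_relPos_eq` + (A.3v);
`(δ Θ_σ ϖ^a)·𝒪^N = δ·(ϖ^a·𝒪^N)^♯` by ★ J2′ `latt_mul_qsInvolution`) — the relative position of an apartment vertex to its `δ`-twisted polar, the summand of the
lattice count ★ J2′ `ncard_twistedShell_eq_ncard_latt_relPos_dual` on the standard apartment. [cite: Kottwitz1986BaseChangeUnits, §1 pp. 240–242, §3]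
[cite: Macdonald1995, Ch. V §2 (2.6)] -/
theorem relPos_zpowDiagGL_diagonalGL_mul_qsInvolution_eq_iff (hvσ : ∀ a, Valued.v (σ a) = Valued.v a)
    {d : Fin N → Kˣ} {c : Fin N → ℤ} (hd : ∀ i, Valued.v (d i : K) = Valued.v (ϖ ^ c i)) (a la : Fin N → ℤ) :
    relPos hϖ (zpowDiagGL hϖ.ne_zero a) (diagonalGL (Fin N) K d * UnitaryGroup.qsInvolution σ (zpowDiagGL hϖ.ne_zero a)) = la ↔
      Antitone la ∧ ∃ τ : Equiv.Perm (Fin N), ∀ i, c (τ i) - a (τ i) - a (Fin.rev (τ i)) = la i := by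
  constructor
  · intro h
    have hla : Antitone la := h ▸ antitone_relPos hϖ _ _
    refine ⟨hla, (zpowDiagGL_inv_mul_diagonalGL_mul_qsInvolution_mem_doubleCoset_iff hϖ hvσ hd a la).1 ?_⟩
    rw [mul_assoc (zpowDiagGL hϖ.ne_zero a)⁻¹]
    exact (inv_mul_mem_doubleCoset_iff_relPos_eq hϖ hla _ _).2 h
  · rintro ⟨hla, hτ⟩
    have h := (zpowDiagGL_inv_mul_diagonalGL_mul_qsInvolution_mem_doubleCoset_iff hϖ hvσ hd a la).2 hτ
    rw [mul_assoc (zpowDiagGL hϖ.ne_zero a)⁻¹] at h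
    exact (inv_mul_mem_doubleCoset_iff_relPos_eq hϖ hla _ _).1 h

end Shell

/-! ## §4 (A.5) The exponent vector `c − a − w₀a`: invariance under the `T`-shifts, and its `ℤ²`-parametrisation at `N = 3` -/

section Exponents

/-- **(A.5a) SHIFT INVARIANCE OF THE TWISTED EXPONENT VECTOR** (any `N`): if `s + w₀s = 0` (`∀ i, s i + s (rev i) = 0` — the valuation vectors of the torus `T` of
(A.4a): `v(τ_i) · v(σ τ_{rev i}) = 1`) then `c − (a + s) − w₀(a + s) = c − a − w₀a` entrywise — the predicate of the HEAD (A.3) and the valuation vector of (A.3a) are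
constant on the `T`-orbits `a ↦ a + s` of the apartment, so the twisted constant term ∕ apartment count is a sum over `ℤ^N ⧸ {s : s + w₀s = 0}`.
[cite: Rogawski1990, §4.10 (4.10.2) p. 58] [cite: Kottwitz1986BaseChangeUnits, §3] -/
theorem sub_sub_rev_add_of_add_rev_eq_zero {N : ℕ} (c a s : Fin N → ℤ) (hs : ∀ i, s i + s (Fin.rev i) = 0) (j : Fin N) :
    c j - (a + s) j - (a + s) (Fin.rev j) = c j - a j - a (Fin.rev j) := by
  have h := hs j
  simp only [Pi.add_apply]
  omega

/-- **(A.5b) THE `ℤ²`-PARAMETRISATION AT `N = 3`** (`w₀ = rev` swaps `0 ↔ 2` and fixes `1`): `c − a − w₀a = (c₀ − (a₀ + a₂), c₁ − 2a₁, c₂ − (a₀ + a₂))` entrywise — the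
twisted exponent vector depends on `a ∈ ℤ³` only through `(a₀ + a₂, a₁) ∈ ℤ²` (the quotient of `ℤ³` by the shifts `(m, 0, −m)` of (A.5a)), the index set of TB2a's
finite sum at a hyperbolic-norm `δ`; the middle entry has the parity of `c₁`, the outer two differ by `c₀ − c₂` (the valuation of the norm `δ Θ_σ(δ)` on the split torus).
[cite: Rogawski1990, §4.10 p. 58] [cite: Kottwitz1986BaseChangeUnits, §3] -/
theorem sub_sub_rev_fin_three (c a : Fin 3 → ℤ) (j : Fin 3) :
    c j - a j - a (Fin.rev j) = ![c 0 - (a 0 + a 2), c 1 - 2 * a 1, c 2 - (a 0 + a 2)] j := by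
  fin_cases j
  · show c 0 - a 0 - a (Fin.rev 0) = c 0 - (a 0 + a 2)
    rw [show Fin.rev (0 : Fin 3) = 2 from rfl]
    ring
  · show c 1 - a 1 - a (Fin.rev 1) = c 1 - 2 * a 1
    rw [show Fin.rev (1 : Fin 3) = 1 from rfl]
    ring
  · show c 2 - a 2 - a (Fin.rev 2) = c 2 - (a 0 + a 2)
    rw [show Fin.rev (2 : Fin 3) = 0 from rfl]
    ring

end Exponents

end Summit.HodgeConjecture.HodgeConjecture.R90.S6

end
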